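import Literature.NumberTheory.NumberFields.EisensteinFieldLocal
import Literature.NumberTheory.NumberFields.EisensteinFieldPrimes
import Mathlib.RingTheory.Ideal.Norm.AbsNorm
import HarnessLib

/-!
# The place `(ϖ)` of `ℚ(ζ₃)` above a split rational prime `q = a² − ab + b² ≡ 1 (mod 3)`: membership of naturals,
# norm `q`, and the valuations of rationals — the dischargers of a split KILLING place of the `3`-isogeny descent

Topic `NumberTheory/NumberFields`; namespace `Literature.NumberTheory.NumberFields.K3`. Companion of
`EisensteinFieldInertKillPlace` for the booking form `CPMuDescent.shaCorank_three_eq_zero_of_gens_of_nodeKill`: at a split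
prime `q ∣ s`, `q ≢ 1 (mod 9)`, the place `w₀ = (ϖ)`, `ϖ = a + bζ`, `N(ϖ) = q`, has residue field `𝔽_q` in which `ζ₃` is not
a cube. All side conditions are reduced to divisibilities in `ℕ` through the norm `N(a + bζ) = a² − ab + b²`
(Ireland–Rosen Prop. 9.1.4):

* `dvd_of_mkInt_dvd_natCast` — `ϖ ∣ n` in `𝓞 K3` ⟹ `q ∣ n` (`N(ϖ) = q ∣ N(n) = n²`);
* `natCast_mem_placeOfPrime_mkInt_iff` — `n ∈ (ϖ) ↔ q ∣ n`;
* `absNorm_placeOfPrime_mkInt` — `N((ϖ)) = q`;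
* `valuation_placeOfPrime_mkInt_natCast_eq_one`, `valuation_placeOfPrime_mkInt_ratCast_lt_one_of_dvd` — `w₀(c) = 1` for
  `q ∤ c` and `w₀(A/B) < 1` for `q ∣ A`, `q ∤ B`.

## References
* [IrelandRosen1990] K. Ireland, M. Rosen, *A Classical Introduction to Modern Number Theory*, 2nd ed., GTM 84, Ch. 9
  §1, Prop. 9.1.4 (split primes of `ℤ[ω]` have residue field of order `q`).
-/

noncomputable section

open NumberField IsDedekindDomain IsDedekindDomain.HeightOneSpectrum

namespace Literature.NumberTheory.NumberFields

namespace K3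

section SplitPlace

variable {a b : ℤ} {q : ℕ} (hq : q.Prime) (hn : a ^ 2 - a * b + b ^ 2 = q)
include hq hn

/-- **`ϖ ∣ n` in `𝓞 K3` forces `q ∣ n`** for `N(ϖ) = q` prime (`q ∣ N(n) = n²`). [cite: IrelandRosen1990, Prop. 9.1.4] -/
theorem dvd_of_mkInt_dvd_natCast {n : ℕ} (h : mkInt a b ∣ ((n : ℕ) : 𝓞 K3)) : q ∣ n := by
  have hN := map_dvd (Algebra.norm ℤ) h
  rw [algebraNorm_mkInt, hn, show ((n : ℕ) : 𝓞 K3) = mkInt n 0 by rw [mkInt_intCast, Int.cast_natCast],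
    algebraNorm_mkInt] at hN
  have h2 : (q : ℤ) ∣ (n : ℤ) ^ 2 := by simpa [sq] using hN
  have h3 : (q : ℤ) ∣ (n : ℤ) := (Int.prime_iff_natAbs_prime.mpr (by simpa using hq)).dvd_of_dvd_pow h2
  exact_mod_cast h3

omit hq in
/-- `q ∣ n` gives `ϖ ∣ n` (`q = ϖ ϖ̄`). [cite: IrelandRosen1990, Prop. 9.1.4] -/
theorem mkInt_dvd_natCast_of_dvd {n : ℕ} (h : q ∣ n) : mkInt a b ∣ ((n : ℕ) : 𝓞 K3) := by
  have hq' : mkInt a b ∣ ((q : ℕ) : 𝓞 K3) := by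
    refine ⟨mkInt (a - b) (-b), ?_⟩
    rw [mkInt_mul_conj, hn, Int.cast_natCast]
  exact hq'.trans (Nat.cast_dvd_cast h)

/-- The ideal of the place `(ϖ)` is `span {ϖ}`. [cite: IrelandRosen1990, Prop. 9.1.4] -/
theorem placeOfPrime_mkInt_asIdeal : (placeOfPrime (prime_mkInt_of_norm_eq_prime hq hn)).asIdeal =
    Ideal.span {mkInt a b} := rfl

/-- **`n ∈ (ϖ) ↔ q ∣ n`** for a natural number `n`. [cite: IrelandRosen1990, Prop. 9.1.4] -/
theorem natCast_mem_placeOfPrime_mkInt_iff (n : ℕ) :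
    ((n : ℕ) : 𝓞 K3) ∈ (placeOfPrime (prime_mkInt_of_norm_eq_prime hq hn)).asIdeal ↔ q ∣ n := by
  rw [placeOfPrime_mkInt_asIdeal hq hn, Ideal.mem_span_singleton]
  exact ⟨dvd_of_mkInt_dvd_natCast hq hn, mkInt_dvd_natCast_of_dvd hn⟩

/-- **`N((ϖ)) = q`**. [cite: IrelandRosen1990, Prop. 9.1.4] -/
theorem absNorm_placeOfPrime_mkInt :
    Ideal.absNorm (placeOfPrime (prime_mkInt_of_norm_eq_prime hq hn)).asIdeal = q := by
  rw [placeOfPrime_mkInt_asIdeal hq hn, absNorm_span_mkInt, hn]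
  simp

/-- `w₀(c) = 1` at `w₀ = (ϖ)` for a natural `c` with `q ∤ c`. [cite: IrelandRosen1990, Prop. 9.1.4] -/
theorem valuation_placeOfPrime_mkInt_natCast_eq_one {c : ℕ} (hc : ¬ q ∣ c) :
    (placeOfPrime (prime_mkInt_of_norm_eq_prime hq hn)).valuation K3 (c : K3) = 1 := by
  rw [← coe_natCast_ringOfIntegers]
  exact (val_coe_eq_one_iff (prime_mkInt_of_norm_eq_prime hq hn) _).mpr
    (fun h => hc (dvd_of_mkInt_dvd_natCast hq hn h))

/-- **`w₀(A/B) < 1`** at `w₀ = (ϖ)` for naturals with `q ∣ A`, `q ∤ B` (e.g. `s = A/2`). [cite: IrelandRosen1990, Prop. 9.1.4] -/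
theorem valuation_placeOfPrime_mkInt_ratCast_lt_one_of_dvd {x : ℚ} {A B : ℕ} (hA : q ∣ A) (hB : ¬ q ∣ B)
    (hx : x = A / B ∨ x = -(A / B)) :
    (placeOfPrime (prime_mkInt_of_norm_eq_prime hq hn)).valuation K3 (algebraMap ℚ K3 x) < 1 := by
  have hvA : (placeOfPrime (prime_mkInt_of_norm_eq_prime hq hn)).valuation K3 (A : K3) < 1 := by
    rw [← coe_natCast_ringOfIntegers]
    exact (val_coe_lt_one_iff (prime_mkInt_of_norm_eq_prime hq hn) _).mpr (mkInt_dvd_natCast_of_dvd hn hA)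
  have hvB := valuation_placeOfPrime_mkInt_natCast_eq_one hq hn hB
  have e : (placeOfPrime (prime_mkInt_of_norm_eq_prime hq hn)).valuation K3 (algebraMap ℚ K3 (A / B)) < 1 := by
    rw [map_div₀, map_natCast, map_natCast, map_div₀, hvB, div_one]; exact hvA
  rcases hx with rfl | rfl
  · exact e
  · rw [map_neg, Valuation.map_neg]; exact e

end SplitPlace

end K3

end Literature.NumberTheory.NumberFields

end
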